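/-
Copyright (c) 2026 the pub-hodgecm-mathlib formalisation cell (harness21).  Prover seat hodgecm-mathlib-K2E5-p15 (g3), HCML Track B «K2-LIT»,
h413 = `stmt-HodgeConjecture-24833`, (SC-an) line (lead K2E3-p14 (g3)), road «HC-14-ell», file E4 «THE `𝔲(2)` BASE CASE» — STRUCTURE FILE D
(dealer K2E3-plan (g2) deal (D45); lead RULINGS #7 (R7-1)∕(R7-2)).  2026-09-04.
-/
import Summits.HodgeConjecture.HodgeConjecture.Theorems.K2E3HC14EllU11Volume     -- FILE B′ (this seat): coordinate-ball growth, torus tail; brings FILE B (Haar cut, unimodularity, instances), FILE A′, FILE A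
import Summits.HodgeConjecture.HodgeConjecture.Theorems.K2E3HC14EllU11Fibre      -- FILE C (this seat): `exists_pos_le_normAbs_charpoly_line`, `fibre_threshold_and_diameter`
import HarnessLib

/-!
# h413 ∕ Track B «K2-LIT», road «HC-14-ell», file E4 — STRUCTURE FILE D: THE VOLUME LEMMA — LINEAR GROWTH OF THE ELLIPTIC ORBIT IN `𝔲(1,1)`
# `μ{g ∈ U(σ,Φ₂)(K) : ∀ i j, |b·(g⁻¹ Y g)ᵢⱼ|_K ≤ R} ≤ C·|b|_K^{−1∕2}` for a regular elliptic `Y` (all `b ≠ 0`; one `C = C(Y, R, μ)`)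

Cell `pub/hodgecm-mathlib`, crux H413 = `stmt-HodgeConjecture-24833` (lane `--supports … --as helper`, count-neutral); seat K2E5-p15 (g3); dealer K2E3-plan (g2)
deal (D45); (SC-an) line lead K2E3-p14 (g3) (RULINGS #7).  THEOREMS ONLY (no `def`, no `instance`, no `notation`, no named-fact hypothesis, no `sorry`); never
imports `Cruxes/…/Lines`.  Sixth and last structure file behind §2 (E4-iso) of `Theorems/K2E3HC14EllBaseCaseU2.lean` (HC Thm 13 for the compact Cartans of `𝔲(1,1)`).

THE MATHEMATICS ([HarishChandra1970, Part V §3 Thm. 13]: the orbit of a regular elliptic element has LINEAR volume growth, here in the form needed by the dilation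
`X = a·1 + b·Y ↦ b`).  `𝒮_b = {g : |b·(g⁻¹Yg)ᵢⱼ| ≤ R ∀ i,j}` is right-`K₀`-invariant (§1: `K₀ = U ∩ GL₂(𝒪)` has integral entries, `|·|_K` is ultrametric), so by the Iwasawa
decomposition `U = B₂·K₀` (★) and FILE B's cut, `μ(𝒮_b) = c·μ_B(𝒮_b ∩ B₂)·μ_{K₀}(K₀)` with `μ_B = (t,n) ↦ tn`-image of `α_T ⊗ μ_N` (★ `isHaarMeasure_map_anMap`).  By Tonelli,
`μ_B(𝒮_b ∩ B₂) = ∫_{T₂} μ_N(E_t) dα_T`, and FILE C says: `E_t = ∅` unless `|d₀(t)| ≥ r₀ = √(c₀|b|∕(R|y₁₀|))`, and otherwise `E_t` lies in a left translate of the coordinate ball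
of radius `L·(√|b|·|d₀|)⁻¹`; FILE B′ bounds `μ_N` of that ball by `C_N·√L·(|b|^{1∕4}·√|d₀|)⁻¹` and the torus tail `∫_{|d₀| ≥ r₀} (√|d₀|)⁻¹ dα_T` by `C_T·(√r₀)⁻¹ ∝ |b|^{−1∕4}`:
altogether **`μ(𝒮_b) ≤ C·(√|b|)⁻¹`**.

## References
* [HarishChandra1970] Harish-Chandra (notes by G. van Dijk), *Harmonic Analysis on Reductive p-adic Groups*, LNM 162 (1970), Part V §3 Thm. 13 p. 51.
* [Rogawski1990] J. D. Rogawski, *Automorphic Representations of Unitary Groups in Three Variables*, Ann. of Math. Stud. 123 (1990), §3.6; §4.5 p. 45 (Iwasawa).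
* [DeitmarEchterhoff2014] A. Deitmar, S. Echterhoff, *Principles of Harmonic Analysis*, 2nd ed. (2014), Prop. 1.5.6.
-/

set_option autoImplicit false
set_option linter.dupNamespace false  -- the mandated namespace repeats the single-problem summit's segment (`HodgeConjecture.HodgeConjecture`)

noncomputable section

open Matrix Set Filter Topology MeasureTheory MeasureTheory.Measure ValuativeRel
open scoped MatrixGroups NNReal ENNReal WithZero
open Literature.NumberTheory.Automorphic Literature.NumberTheory.Automorphic.UnitaryGroup Literature.NumberTheory.Automorphic.UnitaryGroup.HeisRing
open Literature.NumberTheory.Automorphic.UnitaryGroup.LineRing Literature.NumberTheory.Automorphic.HermitianLattice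
open Literature.NumberTheory.GaloisRepresentations Literature.NumberTheory.GaloisRepresentations.IsNonarchimedeanLocalField
open Summit.HodgeConjecture.HodgeConjecture.Cruxes.H413.K2E3HC14EllU11Orbit Summit.HodgeConjecture.HodgeConjecture.Cruxes.H413.K2E3HC14EllU11Elliptic
open Summit.HodgeConjecture.HodgeConjecture.Cruxes.H413.K2E3HC14EllU11Haar Summit.HodgeConjecture.HodgeConjecture.Cruxes.H413.K2E3HC14EllU11Volume
open Summit.HodgeConjecture.HodgeConjecture.Cruxes.H413.K2E3HC14EllU11Fibre

namespace Summit.HodgeConjecture.HodgeConjecture.Cruxes.H413.K2E3HC14EllU11OrbitVolume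

/-! ## §1 Entry bounds are stable under conjugation by integral matrices -/

section Entry

variable {K : Type*} [Field K] [ValuativeRel K] [TopologicalSpace K] [IsNonarchimedeanLocalField K]

/-- **`|b·(P W Q)ᵢⱼ| ≤ R` whenever `|b·W_{ac}| ≤ R` for all `a, c` and `P`, `Q` have entries of absolute value `≤ 1`** (`2 × 2`; `|·|_K` is ultrametric). [cite: Rogawski1990, §4.5 p. 45] -/
theorem normAbs_mul_conj_apply_le {P Q W : Matrix (Fin 2) (Fin 2) K} (hP : ∀ i j, normAbs K (P i j) ≤ 1) (hQ : ∀ i j, normAbs K (Q i j) ≤ 1) {b : K} {R : ℝ≥0}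
    (hW : ∀ i j, normAbs K (b * W i j) ≤ R) (i j : Fin 2) : normAbs K (b * (P * W * Q) i j) ≤ R := by
  have h1 : ∀ i c, normAbs K (b * (P * W) i c) ≤ R := by
    intro i c
    rw [Matrix.mul_apply, Fin.sum_univ_two, mul_add, show b * (P i 0 * W 0 c) = P i 0 * (b * W 0 c) by ring,
      show b * (P i 1 * W 1 c) = P i 1 * (b * W 1 c) by ring]
    refine (normAbs_add_le_max _ _).trans (max_le ?_ ?_)
    · rw [map_mul]; exact (mul_le_mul' (hP i 0) (hW 0 c)).trans_eq (one_mul R)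
    · rw [map_mul]; exact (mul_le_mul' (hP i 1) (hW 1 c)).trans_eq (one_mul R)
  rw [Matrix.mul_apply, Fin.sum_univ_two, mul_add, show b * ((P * W) i 0 * Q 0 j) = (b * (P * W) i 0) * Q 0 j by ring,
    show b * ((P * W) i 1 * Q 1 j) = (b * (P * W) i 1) * Q 1 j by ring]
  refine (normAbs_add_le_max _ _).trans (max_le ?_ ?_)
  · rw [map_mul]; exact (mul_le_mul' (h1 i 0) (hQ 0 j)).trans_eq (mul_one R)
  · rw [map_mul]; exact (mul_le_mul' (h1 i 1) (hQ 1 j)).trans_eq (mul_one R)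

end Entry

/-! ## §2 The volume lemma -/

section Volume

variable {K : Type*} [Field K] [Valued K ℤᵐ⁰] [ValuativeRel K] [(Valued.v : Valuation K ℤᵐ⁰).Compatible] [IsNonarchimedeanLocalField K]
  [MeasurableSpace K] [BorelSpace K]
  (σ : K →+* K) (hσ : ∀ x, σ (σ x) = x) (hσv : ∀ x, Valued.v (σ x) = Valued.v x)
  {J : Matrix (Fin 2) (Fin 2) K} (hJ : J = (StdForm.antidiagonal 2).over K)
  [MeasurableSpace ↥(unitaryGroupOfForm σ J)] [BorelSpace ↥(unitaryGroupOfForm σ J)]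

omit [MeasurableSpace K] [BorelSpace K] [MeasurableSpace ↥(unitaryGroupOfForm σ J)] [BorelSpace ↥(unitaryGroupOfForm σ J)] in
/-- An element of `K₀ = U ∩ GL₂(𝒪)` and its inverse have entries of `|·|_K ≤ 1` (★ `mem_unitaryInt_iff`, ★ bridge `v_le_one_iff_valuation_le_one`). [cite: Rogawski1990, §4.5 p. 45] -/
theorem normAbs_apply_le_one_of_mem_unitaryInt {k : ↥(unitaryGroupOfForm σ J)} (hk : k ∈ unitaryInt σ J) (i j : Fin 2) :
    normAbs K (((k : GL (Fin 2) K) : Matrix (Fin 2) (Fin 2) K) i j) ≤ 1 ∧ normAbs K ((((k : GL (Fin 2) K)⁻¹ : GL (Fin 2) K) : Matrix (Fin 2) (Fin 2) K) i j) ≤ 1 := by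
  have h : ∀ x : K, Valued.v x ≤ 1 → normAbs K x ≤ 1 := fun x hx =>
    normAbs_le_one_iff.2 ((Valuation.mem_integer_iff _ _).2 ((v_le_one_iff_valuation_le_one x).1 hx))
  exact ⟨h _ ((mem_unitaryInt_iff.1 hk).1 i j), h _ ((mem_unitaryInt_iff.1 hk).2 i j)⟩

omit [(Valued.v : Valuation K ℤᵐ⁰).Compatible] [MeasurableSpace K] [BorelSpace K] [MeasurableSpace ↥(unitaryGroupOfForm σ J)]
  [BorelSpace ↥(unitaryGroupOfForm σ J)] in
/-- The entry-ball `{g : ∀ i j, |b·(g⁻¹Yg)ᵢⱼ| ≤ R}` is closed in `U`. [cite: HarishChandra1970, Part V §3 Thm. 13 p. 51] -/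
theorem isClosed_conjEntryBall (Y : Matrix (Fin 2) (Fin 2) K) (b : K) (R : ℝ≥0) :
    IsClosed {g : ↥(unitaryGroupOfForm σ J) | ∀ i j,
      normAbs K (b * ((((g : GL (Fin 2) K)⁻¹ : GL (Fin 2) K) : Matrix (Fin 2) (Fin 2) K) * Y * ((g : GL (Fin 2) K) : Matrix (Fin 2) (Fin 2) K)) i j) ≤ R} := by
  have hc : Continuous fun g : ↥(unitaryGroupOfForm σ J) =>
      (((g : GL (Fin 2) K)⁻¹ : GL (Fin 2) K) : Matrix (Fin 2) (Fin 2) K) * Y * ((g : GL (Fin 2) K) : Matrix (Fin 2) (Fin 2) K) :=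
    ((Units.continuous_coe_inv.comp continuous_subtype_val).mul continuous_const).mul (Units.continuous_val.comp continuous_subtype_val)
  simp only [Set.setOf_forall]
  exact isClosed_iInter fun i => isClosed_iInter fun j =>
    isClosed_le (LocalFieldHaar.continuous_normAbs.comp ((continuous_const.mul (hc.matrix_elem i j)))) continuous_const


include hσ hσv hJ in
/-- **THE VOLUME LEMMA — LINEAR GROWTH OF A REGULAR ELLIPTIC ORBIT IN `U(1,1)`.**  `Y ∈ 𝔲(σ, Φ₂)(K)` regular elliptic, `2 ≠ 0`, a `σ`-skew unit exists, `μ` a Haar measure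
on `U = U(σ, Φ₂)(K)`, `R ≥ 0`.  There is ONE constant `C` such that for every `b ≠ 0`:
`μ{g ∈ U : |b·(g⁻¹ Y g)ᵢⱼ|_K ≤ R for all i, j} ≤ C · (√|b|_K)⁻¹`.  (Equivalently: the Haar volume of `{g : g⁻¹Yg ∈ ϖ^{−m}·M₂(𝒪)}` grows like `q^{m}` = the square root of
`|ϖ^{−2m}|_K` — Harish-Chandra's bound `|η|^{1∕2}·Φ_{1_Λ} ≤ const` for the compact Cartan through `Y`.)  Proof: FILE B's cut along `U = B₂·K₀`, Tonelli on `B₂ ≅ T₂ × N₂`, FILE C's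
threshold∕diameter for the fibres, FILE B′'s two growth laws. [cite: HarishChandra1970, Part V §3 Thm. 13 p. 51] [cite: Rogawski1990, §4.5 p. 45] [cite: DeitmarEchterhoff2014, Prop. 1.5.6] -/
theorem exists_measure_conjEntryBall_le (h2 : (2 : K) ≠ 0) (hskew : ∃ δ : K, δ ≠ 0 ∧ σ δ = -δ)
    (μ : Measure ↥(unitaryGroupOfForm σ J)) [μ.IsHaarMeasure]
    {Y : Matrix (Fin 2) (Fin 2) K} (hY : (Y.map σ)ᵀ * J + J * Y = 0) (hYreg : (Matrix.charpoly Y).discr ≠ 0)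
    (hYell : IsCompact {g : ↥(unitaryGroupOfForm σ J) |
      ((g : GL (Fin 2) K) : Matrix (Fin 2) (Fin 2) K) * Y * (((g : GL (Fin 2) K)⁻¹ : GL (Fin 2) K) : Matrix (Fin 2) (Fin 2) K) = Y})
    (R : ℝ≥0) :
    ∃ C : ℝ≥0, ∀ b : K, b ≠ 0 →
      μ {g : ↥(unitaryGroupOfForm σ J) | ∀ i j,
          normAbs K (b * ((((g : GL (Fin 2) K)⁻¹ : GL (Fin 2) K) : Matrix (Fin 2) (Fin 2) K) * Y * ((g : GL (Fin 2) K) : Matrix (Fin 2) (Fin 2) K)) i j) ≤ R} ≤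
        (C : ℝ≥0∞) * (((NNReal.sqrt (normAbs K b))⁻¹ : ℝ≥0) : ℝ≥0∞) := by
  subst hJ
  classical
  -- frame
  haveI : T2Space K := (isLocalField K).toT2Space
  have hσc : Continuous σ := continuous_of_forall_v_eq hσv
  haveI : LocallyCompactSpace ↥(unitaryGroupOfForm σ ((StdForm.antidiagonal 2).over K)) := locallyCompactSpace_unitary hσc _
  haveI : SecondCountableTopology ↥(unitaryGroupOfForm σ ((StdForm.antidiagonal 2).over K)) := secondCountableTopology_unitary _
  -- WLOG `R ≥ 1`
  set R' : ℝ≥0 := max R 1 with hR'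
  have hR'0 : 0 < R' := lt_of_lt_of_le one_pos (le_max_right _ _)
  -- the subgroups
  set T := torusU σ ((StdForm.antidiagonal 2).over K) with hTdef
  set N := unipotentU σ ((StdForm.antidiagonal 2).over K) with hNdef
  set B := borelU σ ((StdForm.antidiagonal 2).over K) with hBdef
  set K₀ := unitaryInt σ ((StdForm.antidiagonal 2).over K) with hK₀def
  haveI : BorelSpace ↥T := Subtype.borelSpace _
  haveI : BorelSpace ↥N := Subtype.borelSpace _
  haveI : BorelSpace ↥B := Subtype.borelSpace _
  haveI : BorelSpace ↥K₀ := Subtype.borelSpace _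
  have hTc : IsClosed (T : Set ↥(unitaryGroupOfForm σ ((StdForm.antidiagonal 2).over K))) := isClosed_torusU_two σ _
  have hNc : IsClosed (N : Set ↥(unitaryGroupOfForm σ ((StdForm.antidiagonal 2).over K))) := isClosed_unipotentU σ _
  have hBc : IsClosed (B : Set ↥(unitaryGroupOfForm σ ((StdForm.antidiagonal 2).over K))) := isClosed_borelU σ _
  have hKc : IsCompact (K₀ : Set ↥(unitaryGroupOfForm σ ((StdForm.antidiagonal 2).over K))) := isCompact_unitaryInt' σ hσv
  haveI : LocallyCompactSpace ↥T := hTc.locallyCompactSpace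
  haveI : LocallyCompactSpace ↥N := hNc.locallyCompactSpace
  haveI : LocallyCompactSpace ↥B := hBc.locallyCompactSpace
  haveI : LocallyCompactSpace ↥K₀ := hKc.isClosed.locallyCompactSpace
  haveI : SecondCountableTopology ↥T := TopologicalSpace.Subtype.secondCountableTopology _
  haveI : SecondCountableTopology ↥N := TopologicalSpace.Subtype.secondCountableTopology _
  haveI : SecondCountableTopology ↥B := TopologicalSpace.Subtype.secondCountableTopology _
  haveI : SigmaCompactSpace ↥T := sigmaCompactSpace_of_locallyCompact_secondCountable
  haveI : SigmaCompactSpace ↥N := sigmaCompactSpace_of_locallyCompact_secondCountable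
  set αT : Measure ↥T := Measure.haar with hαT
  set μN : Measure ↥N := Measure.haar with hμN
  set μL : Measure ↥K₀ := Measure.haar with hμL
  -- `B = T ⋉ N` and its Haar measure in coordinates
  have hTB : T ≤ B := torusU_le_borelU σ _
  have hNB : N ≤ B := unipotentU_le_borelU σ _
  have hTN : ∀ a ∈ T, ∀ n ∈ N, a * n * a⁻¹ ∈ N := by
    intro a ha n hn
    have h := (torus_inv_conj_mem_unipotentU_iff σ ((StdForm.antidiagonal 2).over K) (inv_mem ha) n).2 hn
    rwa [inv_inv] at h
  obtain ⟨e, he⟩ := exists_borelHomeomorph_two σ (J := (StdForm.antidiagonal 2).over K) rfl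
  set μB : Measure ↥B := Measure.map (anMap T N B hTB hNB) (αT.prod μN) with hμB
  haveI : μB.IsHaarMeasure := isHaarMeasure_map_anMap B hTB hNB hTN αT μN e he
  -- Iwasawa `U = B·K₀`
  have hBK : ∀ g : ↥(unitaryGroupOfForm σ ((StdForm.antidiagonal 2).over K)), ∃ h ∈ B, ∃ k ∈ K₀, g = h * k := fun g => by
    obtain ⟨b', k, hk, hb', rfl⟩ := exists_eq_upper_mul_unitaryInt hσ hσv g
    exact ⟨b', (mem_borelU_iff b').2 hb', k, hk, rfl⟩
  -- constants
  obtain ⟨c₀, hc₀, hc₀le⟩ := exists_pos_le_normAbs_charpoly_line σ hσ hσv rfl h2 hY hYreg hYell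
  have h10 : Y 1 0 ≠ 0 := apply_one_zero_ne_zero_of_isCompact_centralizer σ hσ rfl hY hYreg hYell
  have hy10 : 0 < normAbs K (Y 1 0) := pos_iff_ne_zero.2 ((map_ne_zero _).2 h10)
  have hn2 : 0 < normAbs K 2 := pos_iff_ne_zero.2 ((map_ne_zero _).2 h2)
  obtain ⟨CN, hCN⟩ := exists_measure_coordBall_le_sqrt σ hσ hσv rfl μN h2 hskew
  obtain ⟨CT, hCT⟩ := exists_setLIntegral_torus_tail_le σ hσ hσv rfl αT
  set c : ℝ≥0 := HaarHK.decompConst hBc hKc hBK μ μB μL with hcdef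
  set C₁ : ℝ≥0 := max (normAbs K (Matrix.charpoly Y).discr / c₀) (normAbs K 4) with hC₁
  set L : ℝ≥0 := NNReal.sqrt (C₁ * R' * normAbs K (Y 1 0)) / (normAbs K 2 * normAbs K (Y 1 0)) with hL
  have hL0 : 0 < L := by
    refine div_pos (NNReal.sqrt_pos.2 (mul_pos (mul_pos ?_ hR'0) hy10)) (mul_pos hn2 hy10)
    refine lt_of_lt_of_le ?_ (le_max_right _ _)
    rw [pos_iff_ne_zero, _root_.map_ne_zero, show (4 : K) = 2 * 2 by norm_num]; exact mul_ne_zero h2 h2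
  set ρ₀ : ℝ≥0 := NNReal.sqrt (NNReal.sqrt (c₀ / (R' * normAbs K (Y 1 0)))) with hρ₀
  have hρ₀0 : 0 < ρ₀ := NNReal.sqrt_pos.2 (NNReal.sqrt_pos.2 (div_pos hc₀ (mul_pos hR'0 hy10)))
  haveI : CompactSpace ↥K₀ := isCompact_iff_compactSpace.1 hKc
  have hLtop : μL univ < ∞ := (isCompact_univ (X := ↥K₀)).measure_lt_top
  refine ⟨c * (μL univ).toNNReal * (CN * NNReal.sqrt L * (CT * ρ₀⁻¹)), fun b hb => ?_⟩
  -- notation for the given `b`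
  set β : ℝ≥0 := normAbs K b with hβ
  have hβ0 : 0 < β := pos_iff_ne_zero.2 ((map_ne_zero _).2 hb)
  set S : Set ↥(unitaryGroupOfForm σ ((StdForm.antidiagonal 2).over K)) := {g | ∀ i j,
      normAbs K (b * ((((g : GL (Fin 2) K)⁻¹ : GL (Fin 2) K) : Matrix (Fin 2) (Fin 2) K) * Y * ((g : GL (Fin 2) K) : Matrix (Fin 2) (Fin 2) K)) i j) ≤ R'} with hSdef
  have hSm : MeasurableSet S := (isClosed_conjEntryBall σ Y b R').measurableSet
  -- `S_R ⊆ S_{R'}`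
  have hmono : {g : ↥(unitaryGroupOfForm σ ((StdForm.antidiagonal 2).over K)) | ∀ i j,
      normAbs K (b * ((((g : GL (Fin 2) K)⁻¹ : GL (Fin 2) K) : Matrix (Fin 2) (Fin 2) K) * Y * ((g : GL (Fin 2) K) : Matrix (Fin 2) (Fin 2) K)) i j) ≤ R} ⊆ S :=
    fun g hg i j => (hg i j).trans (le_max_left _ _)
  refine (measure_mono hmono).trans ?_
  -- right `K₀`-invariance of `S`
  have hSK : ∀ g k : ↥(unitaryGroupOfForm σ ((StdForm.antidiagonal 2).over K)), k ∈ K₀ → (g * k ∈ S ↔ g ∈ S) := by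
    have key : ∀ g k : ↥(unitaryGroupOfForm σ ((StdForm.antidiagonal 2).over K)), k ∈ K₀ → g ∈ S → g * k ∈ S := by
      intro g k hk hg i j
      have hmat : ((((g * k : ↥(unitaryGroupOfForm σ ((StdForm.antidiagonal 2).over K))) : GL (Fin 2) K)⁻¹ : GL (Fin 2) K) : Matrix (Fin 2) (Fin 2) K) * Y *
            (((g * k : ↥(unitaryGroupOfForm σ ((StdForm.antidiagonal 2).over K))) : GL (Fin 2) K) : Matrix (Fin 2) (Fin 2) K) =
          (((k : GL (Fin 2) K)⁻¹ : GL (Fin 2) K) : Matrix (Fin 2) (Fin 2) K) *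
            ((((g : GL (Fin 2) K)⁻¹ : GL (Fin 2) K) : Matrix (Fin 2) (Fin 2) K) * Y * ((g : GL (Fin 2) K) : Matrix (Fin 2) (Fin 2) K)) *
              ((k : GL (Fin 2) K) : Matrix (Fin 2) (Fin 2) K) := by
        rw [Subgroup.coe_mul, _root_.mul_inv_rev, Units.val_mul, Units.val_mul]; simp only [Matrix.mul_assoc]
      rw [hmat]
      obtain hk' := fun i j => normAbs_apply_le_one_of_mem_unitaryInt σ hk i j
      exact normAbs_mul_conj_apply_le (fun i j => (hk' i j).2) (fun i j => (hk' i j).1) hg i j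
    intro g k hk
    refine ⟨fun h => ?_, key g k hk⟩
    have h' := key (g * k) k⁻¹ (inv_mem hk) h
    rwa [mul_inv_cancel_right] at h'
  -- FILE B's cut: `μ S = c·μB(S ∩ B)·μL(K₀)`
  rw [measure_eq_of_mul_right_mem hBc hKc hBK μ μB μL hSm hSK]
  -- `μB(S ∩ B) = (αT ⊗ μN)(E)`, `E` the pull-back along `(t,n) ↦ tn`
  set E : Set (↥T × ↥N) := anMap T N B hTB hNB ⁻¹' (((↑) : ↥B → ↥(unitaryGroupOfForm σ ((StdForm.antidiagonal 2).over K))) ⁻¹' S) with hE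
  have hEm : MeasurableSet E := by
    haveI : BorelSpace (↥T × ↥N) := Prod.borelSpace
    exact ((hSm.preimage continuous_subtype_val.measurable).preimage (continuous_anMap T N B hTB hNB).measurable)
  have hμBS : μB (((↑) : ↥B → ↥(unitaryGroupOfForm σ ((StdForm.antidiagonal 2).over K))) ⁻¹' S) = (αT.prod μN) E := by
    haveI : BorelSpace (↥T × ↥N) := Prod.borelSpace
    rw [hμB, Measure.map_apply (continuous_anMap T N B hTB hNB).measurable (hSm.preimage continuous_subtype_val.measurable)]
  rw [hμBS, Measure.prod_apply hEm]
  -- the fibre bound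
  set φ : ↥T → ℝ≥0 := fun t => normAbs K ((((t : ↥(unitaryGroupOfForm σ ((StdForm.antidiagonal 2).over K))) : GL (Fin 2) K) : Matrix (Fin 2) (Fin 2) K) 0 0) with hφ
  have hφc : Continuous φ := LocalFieldHaar.continuous_normAbs.comp (((Units.continuous_val.comp continuous_subtype_val).comp continuous_subtype_val).matrix_elem 0 0)
  set r₀ : ℝ≥0 := NNReal.sqrt (c₀ * β / (R' * normAbs K (Y 1 0))) with hr₀
  have hr₀0 : 0 < r₀ := NNReal.sqrt_pos.2 (div_pos (mul_pos hc₀ hβ0) (mul_pos hR'0 hy10))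
  set K₁ : ℝ≥0 := CN * NNReal.sqrt L * (NNReal.sqrt (NNReal.sqrt β))⁻¹ with hK₁
  have hfibre : ∀ t : ↥T, μN (Prod.mk t ⁻¹' E) ≤
      Set.indicator {t : ↥T | r₀ ≤ φ t} (fun t => (K₁ : ℝ≥0∞) * (((NNReal.sqrt (φ t))⁻¹ : ℝ≥0) : ℝ≥0∞)) t := by
    intro t
    by_cases hne : (Prod.mk t ⁻¹' E).Nonempty
    swap
    · rw [Set.not_nonempty_iff_eq_empty.1 hne, measure_empty]; exact bot_le
    obtain ⟨n', hn'⟩ := hne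
    obtain ⟨d, hd⟩ := (mem_torusU_iff (t : ↥(unitaryGroupOfForm σ ((StdForm.antidiagonal 2).over K)))).1 t.2
    have hφt : φ t = normAbs K (d 0 : K) := by
      simp only [hφ]; rw [coe_torus_eq_diagonal σ hd, Matrix.diagonal_apply_eq]
    have hφ0 : 0 < φ t := by rw [hφt]; exact pos_iff_ne_zero.2 ((map_ne_zero _).2 (d 0).ne_zero)
    -- membership in `E` unfolds to the `(0,1)` entry bound for `(tn)⁻¹ Y (tn)`
    have hmemE : ∀ m : ↥N, (t, m) ∈ E →
        normAbs K (b * ((((((t : ↥(unitaryGroupOfForm σ ((StdForm.antidiagonal 2).over K))) : GL (Fin 2) K) *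
            ((m : ↥(unitaryGroupOfForm σ ((StdForm.antidiagonal 2).over K))) : GL (Fin 2) K))⁻¹ : GL (Fin 2) K) : Matrix (Fin 2) (Fin 2) K) * Y *
          ((((t : ↥(unitaryGroupOfForm σ ((StdForm.antidiagonal 2).over K))) : GL (Fin 2) K) *
            ((m : ↥(unitaryGroupOfForm σ ((StdForm.antidiagonal 2).over K))) : GL (Fin 2) K) : GL (Fin 2) K) : Matrix (Fin 2) (Fin 2) K)) 0 1) ≤ R' := by
      intro m hm
      have h := hm 0 1
      rwa [coe_anMap, Subgroup.coe_mul] at h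
    -- threshold and diameter from FILE C (with `n'` as the second point)
    have hfib := fun (m : ↥N) (hm : (t, m) ∈ E) => fibre_threshold_and_diameter σ hσ hσv rfl Y hc₀ hc₀le t.2 hd m n' hb rfl rfl
      (hmemE m hm) (hmemE n' hn')
    obtain ⟨hthr, -⟩ := hfib n' hn'
    -- `r₀ ≤ φ t`
    have hr₀φ : r₀ ≤ φ t := by
      rw [← hφt] at hthr
      have hβne : β ≠ 0 := hβ0.ne'
      rw [hr₀, NNReal.sqrt_le_iff_le_sq, div_le_iff₀ (mul_pos hR'0 hy10)]
      calc c₀ * β ≤ R' / β * φ t ^ 2 * normAbs K (Y 1 0) * β := mul_le_mul' hthr le_rfl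
        _ = φ t ^ 2 * (R' * normAbs K (Y 1 0)) := by rw [div_eq_mul_inv]; field_simp
    rw [Set.indicator_of_mem (show t ∈ {t : ↥T | r₀ ≤ φ t} from hr₀φ)]
    -- the fibre lies in a left translate of the coordinate ball of radius `L/(φ·√β)`
    set rad : ℝ≥0 := L / (φ t * NNReal.sqrt β) with hrad
    have hrad0 : 0 < rad := div_pos hL0 (mul_pos hφ0 (NNReal.sqrt_pos.2 hβ0))
    have hsub : Prod.mk t ⁻¹' E ⊆ (fun m : ↥N => n'⁻¹ * m) ⁻¹'
        {u : ↥N | normAbs K ((((u : ↥(unitaryGroupOfForm σ ((StdForm.antidiagonal 2).over K))) : GL (Fin 2) K) : Matrix (Fin 2) (Fin 2) K) 0 1) ≤ rad} := by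
      intro m hm
      obtain ⟨-, hdiam⟩ := hfib m hm
      simp only [Set.mem_preimage, Set.mem_setOf_eq]
      rw [umat_mul_zero_one_two, umat_inv_zero_one_two, neg_add_eq_sub]
      rw [hrad, le_div_iff₀ (mul_pos hφ0 (NNReal.sqrt_pos.2 hβ0)), hL, le_div_iff₀ (mul_pos hn2 hy10)]
      calc normAbs K ((((m : ↥(unitaryGroupOfForm σ ((StdForm.antidiagonal 2).over K))) : GL (Fin 2) K) : Matrix (Fin 2) (Fin 2) K) 0 1 -
              (((n' : ↥(unitaryGroupOfForm σ ((StdForm.antidiagonal 2).over K))) : GL (Fin 2) K) : Matrix (Fin 2) (Fin 2) K) 0 1) * (φ t * NNReal.sqrt β) *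
            (normAbs K 2 * normAbs K (Y 1 0))
          = normAbs K ((((m : ↥(unitaryGroupOfForm σ ((StdForm.antidiagonal 2).over K))) : GL (Fin 2) K) : Matrix (Fin 2) (Fin 2) K) 0 1 -
              (((n' : ↥(unitaryGroupOfForm σ ((StdForm.antidiagonal 2).over K))) : GL (Fin 2) K) : Matrix (Fin 2) (Fin 2) K) 0 1) *
              (normAbs K 2 * normAbs K (d 0 : K) * normAbs K (Y 1 0)) * NNReal.sqrt β := by rw [hφt]; ring
        _ ≤ NNReal.sqrt (C₁ * R' * normAbs K (Y 1 0)) := hdiam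
    calc μN (Prod.mk t ⁻¹' E)
        ≤ μN ((fun m : ↥N => n'⁻¹ * m) ⁻¹' {u : ↥N | normAbs K ((((u : ↥(unitaryGroupOfForm σ ((StdForm.antidiagonal 2).over K))) : GL (Fin 2) K) : Matrix (Fin 2) (Fin 2) K) 0 1) ≤ rad}) :=
          measure_mono hsub
      _ = μN {u : ↥N | normAbs K ((((u : ↥(unitaryGroupOfForm σ ((StdForm.antidiagonal 2).over K))) : GL (Fin 2) K) : Matrix (Fin 2) (Fin 2) K) 0 1) ≤ rad} :=
          measure_preimage_mul μN _ _
      _ ≤ (CN : ℝ≥0∞) * (NNReal.sqrt rad : ℝ≥0∞) := hCN rad hrad0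
      _ = (K₁ : ℝ≥0∞) * (((NNReal.sqrt (φ t))⁻¹ : ℝ≥0) : ℝ≥0∞) := by
          rw [← ENNReal.coe_mul, ← ENNReal.coe_mul, hK₁, hrad, NNReal.sqrt_div, NNReal.sqrt_mul, div_eq_mul_inv, mul_inv]
          push_cast; ring
  -- integrate the fibre bound
  have hmeas : MeasurableSet {t : ↥T | r₀ ≤ φ t} := (isClosed_le continuous_const hφc).measurableSet
  have hint : ∫⁻ t, μN (Prod.mk t ⁻¹' E) ∂αT ≤ (K₁ : ℝ≥0∞) * ((CT : ℝ≥0∞) * (((NNReal.sqrt r₀)⁻¹ : ℝ≥0) : ℝ≥0∞)) := by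
    calc ∫⁻ t, μN (Prod.mk t ⁻¹' E) ∂αT
        ≤ ∫⁻ t, Set.indicator {t : ↥T | r₀ ≤ φ t} (fun t => (K₁ : ℝ≥0∞) * (((NNReal.sqrt (φ t))⁻¹ : ℝ≥0) : ℝ≥0∞)) t ∂αT := lintegral_mono hfibre
      _ = (K₁ : ℝ≥0∞) * ∫⁻ t in {t : ↥T | r₀ ≤ φ t}, (((NNReal.sqrt (φ t))⁻¹ : ℝ≥0) : ℝ≥0∞) ∂αT := by
          rw [lintegral_indicator hmeas, lintegral_const_mul' _ _ ENNReal.coe_ne_top]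
      _ ≤ (K₁ : ℝ≥0∞) * ((CT : ℝ≥0∞) * (((NNReal.sqrt r₀)⁻¹ : ℝ≥0) : ℝ≥0∞)) := mul_le_mul' le_rfl (hCT r₀ hr₀0)
  -- assemble: `(√√β)⁻¹ · (√r₀)⁻¹ = ρ₀⁻¹ · (√√β)⁻¹ · (√√β)⁻¹… = const · (√β)⁻¹`
  have hsqr₀ : NNReal.sqrt r₀ = ρ₀ * NNReal.sqrt (NNReal.sqrt β) := by
    rw [hr₀, hρ₀, ← NNReal.sqrt_mul, ← NNReal.sqrt_mul]
    congr 2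
    rw [div_eq_mul_inv, div_eq_mul_inv]; ring
  have hββ : NNReal.sqrt (NNReal.sqrt β) * NNReal.sqrt (NNReal.sqrt β) = NNReal.sqrt β := NNReal.mul_self_sqrt _
  have hinv : (NNReal.sqrt β)⁻¹ = (NNReal.sqrt (NNReal.sqrt β))⁻¹ * (NNReal.sqrt (NNReal.sqrt β))⁻¹ := by rw [← mul_inv, hββ]
  set m : ℝ≥0 := (μL univ).toNNReal with hm
  have hμm : μL univ = (m : ℝ≥0∞) := (ENNReal.coe_toNNReal hLtop.ne).symm
  rw [← hcdef, hμm]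
  calc (c : ℝ≥0∞) * ((∫⁻ t, μN (Prod.mk t ⁻¹' E) ∂αT) * (m : ℝ≥0∞))
      ≤ (c : ℝ≥0∞) * ((K₁ : ℝ≥0∞) * ((CT : ℝ≥0∞) * (((NNReal.sqrt r₀)⁻¹ : ℝ≥0) : ℝ≥0∞)) * (m : ℝ≥0∞)) := by gcongr
    _ = ((c * m * (CN * NNReal.sqrt L * (CT * ρ₀⁻¹)) : ℝ≥0) : ℝ≥0∞) * (((NNReal.sqrt β)⁻¹ : ℝ≥0) : ℝ≥0∞) := by
        rw [hK₁, hsqr₀, mul_inv, hinv]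
        push_cast
        ring

end Volume

end Summit.HodgeConjecture.HodgeConjecture.Cruxes.H413.K2E3HC14EllU11OrbitVolume

end
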